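import Literature.AlgebraicGeometry.Motives.EllAdicEtaleRational
import HarnessLib

/-!
# The functor `Hⁱ(–, ℚ_ℓ) : (Sch/k)ᵒᵖ ⥤ Mod_{ℚ_ℓ}` of rational `ℓ`-adic étale cohomology of the
# geometric fibre — the shape `PreWeilCohomology.H i`

`PreWeilCohomology k K` (`PreWeilCohomology.lean`) packages a cohomology theory as functors
`H i : (SchemeOver k)ᵒᵖ ⥤ ModuleCat.{u} K`. With `EllAdicEtaleRational.lean`
(`Hⁱ(X_{k̄}, ℚ_ℓ) = ℚ_ℓ ⊗_{ℤ_ℓ} lim_m Hⁱ((X_{k̄})_ét, ℤ/ℓᵐ)` and its functorial `ℚ_ℓ`-linear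
pull-backs) and the functoriality of `X ↦ X_{k̄}` (`geometricFibreHom`, `EtaleGaloisAction.lean`),
this file assembles exactly such a functor for `K = ℚ_ℓ`:

* `geometricFibreHom_id`, `geometricFibreHom_comp` — `X ↦ X_{k̄}`, `φ ↦ φ × 1` is functorial;
* **`ellAdicEtaleH k ℓ i : (SchemeOver k)ᵒᵖ ⥤ ModuleCat.{u} ℚ_[ℓ]`**, `X ↦ Hⁱ(X_{k̄}, ℚ_ℓ)`,
  `φ ↦ (φ × 1)^*` (Deligne, Weil I (1.3): `Hⁱ(X, ℚ_ℓ)` of `X = X₀ ⊗ F̄_q`; Milne V §1), with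
  `ellAdicEtaleH_map_hom` unfolding the pull-back, `ellAdicEtaleH_pullback_ρ` (Galois equivariance, the
  shape of `GaloisWeilCohomology.pullback_ρ`) and `ellAdicEtaleH_frobenius` restating
  Deligne's (1.15.1) `F^* = ρ(F_geom)` in this packaging (the hypothesis (D) of
  `hasLefschetzTraceFormula_of_frobeniusOver`, `LefschetzTraceFormula.lean`, for these `Hⁱ`).

## References

* P. Deligne, *La conjecture de Weil. I* (1974), (1.3) p. 274, (1.15.1) p. 279. [Deligne1974]
* S. L. Kleiman, *Algebraic cycles and the Weil conjectures* (1968), §1.2 (the functor `X ↦ H^*(X)`).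
  [Kleiman1968]

## Design notes

* Only the functor is provided; cup product, unit, trace and cycle classes — the other fields of
  `PreWeilCohomology` — are not constructed here (nor anywhere in the tree yet).
-/

universe u

open CategoryTheory CategoryTheory.Limits AlgebraicGeometry Opposite TensorProduct

namespace Literature.AlgebraicGeometry.Motives

section Fibre

variable {k : Type u} [Field k]

/-- `X ↦ X_{k̄}` is functorial: `(𝟙 X)_{k̄} = 𝟙`. [folklore] -/
@[simp]
theorem geometricFibreHom_id (X : SchemeOver k) : geometricFibreHom (𝟙 X) = 𝟙 (geometricFibre k X) :=
  congrArg CommaMorphism.left ((baseChange k (AlgebraicClosure k)).map_id X)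

/-- `X ↦ X_{k̄}` is functorial: `(φ ≫ ψ)_{k̄} = φ_{k̄} ≫ ψ_{k̄}`. [folklore] -/
theorem geometricFibreHom_comp {X Y Z : SchemeOver k} (φ : X ⟶ Y) (ψ : Y ⟶ Z) :
    geometricFibreHom (φ ≫ ψ) = geometricFibreHom φ ≫ geometricFibreHom ψ :=
  congrArg CommaMorphism.left ((baseChange k (AlgebraicClosure k)).map_comp φ ψ)

end Fibre

section Functor

variable (k : Type u) [Field k] (ℓ : ℕ) [Fact ℓ.Prime] (i : ℕ)

/-- **`Hⁱ(–, ℚ_ℓ) : (Sch/k)ᵒᵖ ⥤ Mod_{ℚ_ℓ}`**, `X ↦ Hⁱ(X_{k̄}, ℚ_ℓ) = ℚ_ℓ ⊗_{ℤ_ℓ} lim_m Hⁱ((X_{k̄})_ét, ℤ/ℓᵐ)`,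
`φ ↦ (φ × 1)^*` — rational `ℓ`-adic étale cohomology of the geometric fibre as a functor of the
shape `PreWeilCohomology.H i` (Deligne, Weil I (1.3); Kleiman §1.2). [cite: Deligne1974, (1.3)] -/
noncomputable def ellAdicEtaleH : (SchemeOver k)ᵒᵖ ⥤ ModuleCat.{u} ℚ_[ℓ] where
  obj X := ModuleCat.of ℚ_[ℓ] (ellAdicEtaleCohomologyRat ℓ i (geometricFibre k X.unop))
  map φ := ModuleCat.ofHom (ellAdicEtaleCohomologyRatPullback ℓ (geometricFibreHom φ.unop) i)
  map_id X := by
    ext : 1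
    change ellAdicEtaleCohomologyRatPullback ℓ (geometricFibreHom (𝟙 X.unop)) i = LinearMap.id
    rw [geometricFibreHom_id, ellAdicEtaleCohomologyRatPullback_id]
  map_comp φ ψ := by
    ext : 1
    change ellAdicEtaleCohomologyRatPullback ℓ (geometricFibreHom (ψ.unop ≫ φ.unop)) i =
      ellAdicEtaleCohomologyRatPullback ℓ (geometricFibreHom ψ.unop) i ∘ₗ
        ellAdicEtaleCohomologyRatPullback ℓ (geometricFibreHom φ.unop) i
    rw [geometricFibreHom_comp, ellAdicEtaleCohomologyRatPullback_comp]

variable {k ℓ i}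

set_option maxHeartbeats 1000000 in
/-- The pull-back of `ellAdicEtaleH` along `φ` is `(φ × 1)^*` on `Hⁱ(–, ℚ_ℓ)` (by `rfl`). [folklore] -/
theorem ellAdicEtaleH_map_hom {X Y : SchemeOver k} (φ : X ⟶ Y) :
    ((ellAdicEtaleH k ℓ i).map φ.op).hom =
      ellAdicEtaleCohomologyRatPullback ℓ (geometricFibreHom φ) i :=
  rfl

set_option maxHeartbeats 1000000 in
/-- **Deligne (1.15.1) for `ellAdicEtaleH`**: over a finite field, the pull-back along the
`k`-Frobenius `F_{X/k}` is the action of the geometric Frobenius on `Hⁱ(X_{k̄}, ℚ_ℓ)` — the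
hypothesis (D) `ρ X i (geomFrob k) = pullback (frobeniusOver X) i` of
`hasLefschetzTraceFormula_of_frobeniusOver` for these `Hⁱ` and `ρ = geometricEllAdicEtaleCohomologyRepRat`.
[cite: Deligne1974, (1.15.1)] -/
theorem ellAdicEtaleH_frobenius [Finite k] (X : SchemeOver k) :
    (geometricEllAdicEtaleCohomologyRepRat ℓ X i (geomFrob k) : _ →ₗ[ℚ_[ℓ]] _) =
      ((ellAdicEtaleH k ℓ i).map (frobeniusOver X).op).hom :=
  (ellAdicEtaleCohomologyRatPullback_frobenius_eq_geomFrob ℓ X i).symm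

set_option maxHeartbeats 1000000 in
/-- **Galois-equivariance of the pull-backs of `ellAdicEtaleH`** — the shape of the axiom
`GaloisWeilCohomology.pullback_ρ` (`ρ X i g ∘ pullback φ = pullback φ ∘ ρ Y i g`) for
`ρ = geometricEllAdicEtaleCohomologyRepRat`. [folklore] -/
theorem ellAdicEtaleH_pullback_ρ {X Y : SchemeOver k} (φ : X ⟶ Y) (g : Field.absoluteGaloisGroup k) :
    geometricEllAdicEtaleCohomologyRepRat ℓ X i g ∘ₗ ((ellAdicEtaleH k ℓ i).map φ.op).hom =
      ((ellAdicEtaleH k ℓ i).map φ.op).hom ∘ₗ geometricEllAdicEtaleCohomologyRepRat ℓ Y i g :=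
  geometricEllAdicEtaleCohomologyRepRat_pullback ℓ i φ g

end Functor

end Literature.AlgebraicGeometry.Motives
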